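import Summits.RiemannHypothesis.RiemannHypothesis.Theorems.SignConeConeMagnificationLandau

/-!
# Sign-cone magnification — the Landau PINCH of surplus and deficit under an off-line zero

Route `SignCone`, crux `ConeMagnification` (stmt-RiemannHypothesis-16303), line `Sketch` r5/r6 (the `¬ RH` world;
line card §5 "WHAT ¬RH ADDS").  For `c ≥ 0` with `Σ c(n) n^{-σ} < ∞` (`σ > 1`) and ONE `F` holomorphic on
`re s > 1/2` continuing `L_c(s) - 1/(s-1)`, split `c - Λ` into surplus `u = (c-Λ)₊` and deficit `d = (Λ-c)₊`;
on `re s > 1`, `L_u = F + ζ₁'/ζ₁ + L_d` (`SignCone.LSeries_posPart_sub_vonMangoldt`).  For ANY zero `ρ` of `ζ`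
with `re ρ > 1/2`: `re ρ ≤ max (σₐ(u), σₐ(d))` (`re_le_max_abscissa_posPart`: else `ζ₁' = Ψ ζ₁` near `ρ` with
`Ψ = L_u - L_d - F` holomorphic, forcing `ζ₁ ≡ 0`); each abscissa is `≤ max (other, 1/2)`
(`abscissa_posPart_le_of_deficit`, `abscissa_deficit_le_of_posPart`: Landau along the real axis, where `F`,
`ζ₁'/ζ₁` — no zeros of `ζ₁` on the strip about `[1/2, 5]`, `TuranLiouville` — and the other series are
holomorphic); hence `σₐ(u) = σₐ(d) ≥ re ρ` (`abscissa_posPart_eq_of_riemannZeta_eq_zero`) and, under `¬ RH`,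
NEITHER surplus NOR deficit converges at any `σ < θ` for some `θ > 1/2`
(`not_lseriesSummable_posPart_of_not_riemannHypothesis`; the deficit half is the contraposed `stub_transfer`,
quantified by the zero; the surplus half is new).  Mathlib + the tree's Landau / Turán–Liouville library only.
-/


noncomputable section

open Complex Filter Set Metric Topology LSeries
open scoped ArithmeticFunction.vonMangoldt

namespace Summit.RiemannHypothesis.RiemannHypothesis.Theorems.SignConeConeMagnification

open Literature.NumberTheory.LFunctions
open Summit.RiemannHypothesis.RiemannHypothesis.Theorems.SignCone

/-! ## Absolute convergence of surplus and deficit on `re s > 1` -/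

/-- For `c ≥ 0` with `Σ c(n) n^{-σ} < ∞` (`σ > 1`): at every `s` with `re s > 1` the series of `c`, of the
surplus `(c - Λ)₊` and of the deficit `(Λ - c)₊` converge absolutely (comparison with `c + Λ`). [folklore] -/
theorem lseriesSummable_posPart_of_one_lt {c : ℕ → ℝ} (hc : ∀ n, 0 ≤ c n)
    (hsum : ∀ σ : ℝ, 1 < σ → LSeriesSummable (fun n => ((c n : ℝ) : ℂ)) σ) {s : ℂ} (hs : 1 < s.re) :
    LSeriesSummable (fun n => ((c n : ℝ) : ℂ)) s ∧
      LSeriesSummable (fun n => ((max (c n - Λ n) 0 : ℝ) : ℂ)) s ∧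
        LSeriesSummable (fun n => ((max (Λ n - c n) 0 : ℝ) : ℂ)) s := by
  have hcs : LSeriesSummable (fun n => ((c n : ℝ) : ℂ)) s :=
    (hsum s.re hs).of_re_le_re (by rw [ofReal_re])
  have hΛs : LSeriesSummable (fun n => ((Λ n : ℝ) : ℂ)) s :=
    ArithmeticFunction.LSeriesSummable_vonMangoldt hs
  have hcΛ := hcs.add hΛs
  have hnorm : ∀ n : ℕ, ‖((fun n => ((c n : ℝ) : ℂ)) + fun n => ((Λ n : ℝ) : ℂ)) n‖ = c n + Λ n := by
    intro n
    simp only [Pi.add_apply]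
    rw [← ofReal_add, Complex.norm_real,
      Real.norm_of_nonneg (add_nonneg (hc n) ArithmeticFunction.vonMangoldt_nonneg)]
  refine ⟨hcs, ?_, ?_⟩
  · refine Summable.of_norm_bounded hcΛ.norm fun n => norm_term_le _ ?_
    rw [hnorm n, Complex.norm_real, Real.norm_of_nonneg (le_max_right _ _)]
    exact max_le (by linarith [ArithmeticFunction.vonMangoldt_nonneg (n := n)])
      (add_nonneg (hc n) ArithmeticFunction.vonMangoldt_nonneg)
  · refine Summable.of_norm_bounded hcΛ.norm fun n => norm_term_le _ ?_
    rw [hnorm n, Complex.norm_real, Real.norm_of_nonneg (le_max_right _ _)]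
    exact max_le (by linarith [hc n]) (add_nonneg (hc n) ArithmeticFunction.vonMangoldt_nonneg)

/-- The abscissae of absolute convergence of `c`, `(c - Λ)₊`, `(Λ - c)₊` are all `≤ 1`. [folklore] -/
theorem abscissa_posPart_le_one {c : ℕ → ℝ} (hc : ∀ n, 0 ≤ c n)
    (hsum : ∀ σ : ℝ, 1 < σ → LSeriesSummable (fun n => ((c n : ℝ) : ℂ)) σ) :
    abscissaOfAbsConv (fun n => ((c n : ℝ) : ℂ)) ≤ (1 : ℝ) ∧
      abscissaOfAbsConv (fun n => ((max (c n - Λ n) 0 : ℝ) : ℂ)) ≤ (1 : ℝ) ∧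
        abscissaOfAbsConv (fun n => ((max (Λ n - c n) 0 : ℝ) : ℂ)) ≤ (1 : ℝ) := by
  refine ⟨abscissaOfAbsConv_le_of_forall_lt_LSeriesSummable fun y hy => ?_,
    abscissaOfAbsConv_le_of_forall_lt_LSeriesSummable fun y hy => ?_,
    abscissaOfAbsConv_le_of_forall_lt_LSeriesSummable fun y hy => ?_⟩
  · exact (lseriesSummable_posPart_of_one_lt hc hsum (s := y) (by rwa [ofReal_re])).1
  · exact (lseriesSummable_posPart_of_one_lt hc hsum (s := y) (by rwa [ofReal_re])).2.1
  · exact (lseriesSummable_posPart_of_one_lt hc hsum (s := y) (by rwa [ofReal_re])).2.2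

/-- **The surplus–deficit identity on `re s > 1`.**  With `F = L_c - 1/(s-1)` there:
`L_{(c-Λ)₊}(s) = F(s) + ζ₁'(s)/ζ₁(s) + L_{(Λ-c)₊}(s)`. [folklore] -/
theorem LSeries_posPart_eq_add {c : ℕ → ℝ} (hc : ∀ n, 0 ≤ c n)
    (hsum : ∀ σ : ℝ, 1 < σ → LSeriesSummable (fun n => ((c n : ℝ) : ℂ)) σ) {F : ℂ → ℂ}
    (hF : ∀ s : ℂ, 1 < s.re → F s = LSeries (fun n => ((c n : ℝ) : ℂ)) s - 1 / (s - 1))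
    {s : ℂ} (hs : 1 < s.re) :
    LSeries (fun n => ((max (c n - Λ n) 0 : ℝ) : ℂ)) s =
      F s + logDeriv riemannZeta₁ s + LSeries (fun n => ((max (Λ n - c n) 0 : ℝ) : ℂ)) s := by
  obtain ⟨hcs, -, hds⟩ := lseriesSummable_posPart_of_one_lt hc hsum hs
  rw [LSeries_posPart_sub_vonMangoldt hs hcs hds, hF s hs, one_div]

/-! ## No off-line zero to the right of both abscissae -/

/-- **Surplus and deficit cannot both converge to the left of an off-line zero.**  If `ζ(ρ) = 0`,
`re ρ > 1/2`, then `re ρ ≤ max (σₐ((c-Λ)₊), σₐ((Λ-c)₊))`: otherwise `Ψ = L_{(c-Λ)₊} - L_{(Λ-c)₊} - F` is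
holomorphic on a half-plane `re s > m` containing `ρ`, `ζ₁' = Ψ ζ₁` there (it holds on `re s > 1`, identity
theorem), and `ζ₁(ρ) = 0` forces `ζ₁ ≡ 0` near `ρ` (`eqOn_zero_of_deriv_eq_mul`), hence everywhere —
contradicting `ζ₁(1) = 1`. [folklore] -/
theorem re_le_max_abscissa_posPart {c : ℕ → ℝ} (hc : ∀ n, 0 ≤ c n)
    (hsum : ∀ σ : ℝ, 1 < σ → LSeriesSummable (fun n => ((c n : ℝ) : ℂ)) σ) {F : ℂ → ℂ}
    (hFd : DifferentiableOn ℂ F {s : ℂ | 1 / 2 < s.re})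
    (hF : ∀ s : ℂ, 1 < s.re → F s = LSeries (fun n => ((c n : ℝ) : ℂ)) s - 1 / (s - 1))
    {ρ : ℂ} (hζ : riemannZeta ρ = 0) (hρ : 1 / 2 < ρ.re) :
    (ρ.re : EReal) ≤ max (abscissaOfAbsConv (fun n => ((max (c n - Λ n) 0 : ℝ) : ℂ)))
      (abscissaOfAbsConv (fun n => ((max (Λ n - c n) 0 : ℝ) : ℂ))) := by
  set fu : ℕ → ℂ := fun n => ((max (c n - Λ n) 0 : ℝ) : ℂ) with hfu
  set fd : ℕ → ℂ := fun n => ((max (Λ n - c n) 0 : ℝ) : ℂ) with hfd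
  by_contra! hlt
  obtain ⟨hu, hd'⟩ := max_lt_iff.1 hlt
  -- a real `m < re ρ`, `m ≥ 1/2`, to the right of both abscissae
  obtain ⟨m₁, hm₁, hm₁ρ⟩ := EReal.lt_iff_exists_real_btwn.1 hu
  obtain ⟨m₂, hm₂, hm₂ρ⟩ := EReal.lt_iff_exists_real_btwn.1 hd'
  set m : ℝ := max (max m₁ m₂) (1 / 2) with hm
  have hmρ : m < ρ.re := max_lt (max_lt (by exact_mod_cast hm₁ρ) (by exact_mod_cast hm₂ρ)) hρ
  have hm_half : 1 / 2 ≤ m := le_max_right _ _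
  have hum : abscissaOfAbsConv fu < m :=
    hm₁.trans_le (by exact_mod_cast (le_max_left _ _).trans (le_max_left _ _))
  have hdm : abscissaOfAbsConv fd < m :=
    hm₂.trans_le (by exact_mod_cast (le_max_right _ _).trans (le_max_left _ _))
  -- facts about `ρ`
  have hρ1 : ρ.re < 1 := by
    by_contra! h
    exact riemannZeta_ne_zero_of_one_le_re h hζ
  have hρne : ρ ≠ 1 := by intro h; rw [h, one_re] at hρ1; exact lt_irrefl _ hρ1
  have hζ₁ρ : riemannZeta₁ ρ = 0 := by
    have h := riemannZeta_eq_inv_sub_mul hρne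
    rw [hζ] at h
    rcases mul_eq_zero.1 h.symm with h0 | h0
    · exact absurd h0 (inv_ne_zero (sub_ne_zero.2 hρne))
    · exact h0
  -- the half-plane `W = {re s > m}` and the holomorphic `Ψ`
  set W : Set ℂ := {s : ℂ | m < s.re} with hW
  have hWo : IsOpen W := isOpen_lt continuous_const continuous_re
  have hρW : ρ ∈ W := hmρ
  have hDu : DifferentiableOn ℂ (LSeries fu) W := fun s hs =>
    (LSeries_analyticOnNhd fu s (hum.trans (by exact_mod_cast hs))).differentiableAt.differentiableWithinAt
  have hDd : DifferentiableOn ℂ (LSeries fd) W := fun s hs =>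
    (LSeries_analyticOnNhd fd s (hdm.trans (by exact_mod_cast hs))).differentiableAt.differentiableWithinAt
  have hFW : DifferentiableOn ℂ F W := hFd.mono fun s hs => by
    show 1 / 2 < s.re; have : m < s.re := hs; linarith
  set Ψ : ℂ → ℂ := fun s => LSeries fu s - LSeries fd s - F s with hΨ
  have hΨd : DifferentiableOn ℂ Ψ W := (hDu.sub hDd).sub hFW
  -- `ζ₁' = Ψ ζ₁` on `re s > 2`, hence on `W`
  have hζ₁V : ∀ s : ℂ, 1 < s.re → riemannZeta₁ s ≠ 0 := fun s hs => (neg_deriv_riemannZeta_div_eq hs).1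
  have hODE_V : ∀ s : ℂ, 2 < s.re → deriv riemannZeta₁ s = Ψ s * riemannZeta₁ s := by
    intro s hs
    have hne := hζ₁V s (by linarith)
    have hΨs : Ψ s = logDeriv riemannZeta₁ s := by
      simp only [hΨ]
      rw [LSeries_posPart_eq_add hc hsum hF (by linarith : 1 < s.re)]
      ring
    rw [hΨs, logDeriv_apply, div_mul_cancel₀ _ hne]
  have hL : AnalyticOnNhd ℂ (deriv riemannZeta₁) W := fun s _ =>
    (differentiable_riemannZeta₁.analyticAt s).deriv
  have hR : AnalyticOnNhd ℂ (fun s => Ψ s * riemannZeta₁ s) W :=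
    (hΨd.mul fun s _ => (differentiable_riemannZeta₁ s).differentiableWithinAt).analyticOnNhd hWo
  set p : ℂ := ((3 : ℝ) : ℂ) with hp
  have hpW : p ∈ W := by show m < p.re; rw [hp, ofReal_re]; linarith
  have hV3 : IsOpen {s : ℂ | 2 < s.re} := isOpen_lt continuous_const continuous_re
  have hp3 : p ∈ {s : ℂ | 2 < s.re} := by show 2 < p.re; rw [hp, ofReal_re]; norm_num
  have hev : deriv riemannZeta₁ =ᶠ[𝓝 p] fun s => Ψ s * riemannZeta₁ s :=
    eventuallyEq_of_mem (hV3.mem_nhds hp3) fun s hs => hODE_V s hs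
  have hODE : EqOn (deriv riemannZeta₁) (fun s => Ψ s * riemannZeta₁ s) W :=
    hL.eqOn_of_preconnected_of_eventuallyEq hR (convex_halfSpace_re_gt m).isPreconnected hpW hev
  -- `ζ₁ ≡ 0` near `ρ`, hence everywhere: contradiction with `ζ₁(1) = 1`
  obtain ⟨r, hr, hball⟩ := Metric.isOpen_iff.1 hWo ρ hρW
  have hzero : ∀ z ∈ ball ρ r, riemannZeta₁ z = 0 :=
    eqOn_zero_of_deriv_eq_mul hr (hΨd.mono hball) differentiable_riemannZeta₁.differentiableOn
      (fun z hz => hODE (hball hz)) hζ₁ρ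
  have hev0 : riemannZeta₁ =ᶠ[𝓝 ρ] 0 :=
    eventuallyEq_of_mem (isOpen_ball.mem_nhds (mem_ball_self hr)) fun z hz => hzero z hz
  have hall0 : EqOn riemannZeta₁ 0 univ :=
    (differentiable_riemannZeta₁.differentiableOn.analyticOnNhd
      isOpen_univ).eqOn_zero_of_preconnected_of_eventuallyEq_zero isPreconnected_univ (mem_univ ρ) hev0
  have h1 := hall0 (mem_univ (1 : ℂ))
  rw [riemannZeta₁_one] at h1
  exact one_ne_zero h1

/-! ## Landau along the real axis: the two abscissae coincide above `1/2` -/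

/-- **Landau along a thin rectangle about the real axis.**  Let `g ≥ 0` with `Σ g(n) n^{-2} < ∞`.  If
`L_g` agrees on `re s > 2` with a function `Φ` holomorphic on `{re s > 2} ∪ R`, `R` the thin open rectangle
`(a₀, 4) × (-δ, δ)`, then `σₐ(g) ≤ a₀` (`Landau.summable_of_differentiableOn_union_convex` for the generalized
Dirichlet series with frequencies `log n`). [folklore] -/
theorem abscissa_le_of_differentiableOn_thinRect {g : ℕ → ℝ} (hg : ∀ n, 0 ≤ g n) {a₀ δ : ℝ}
    (ha₀ : a₀ < 2) (hδ : 0 < δ) (h2 : LSeriesSummable (fun n => ((g n : ℝ) : ℂ)) (2 : ℝ))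
    {Φ : ℂ → ℂ}
    (hΦ : DifferentiableOn ℂ Φ ({s : ℂ | 2 < s.re} ∪
      {s : ℂ | a₀ < s.re ∧ s.re < 4 ∧ -δ < s.im ∧ s.im < δ}))
    (hagree : ∀ s : ℂ, 2 < s.re → Φ s = LSeries (fun n => ((g n : ℝ) : ℂ)) s) :
    abscissaOfAbsConv (fun n => ((g n : ℝ) : ℂ)) ≤ a₀ := by
  set a : ℕ → ℝ := fun n => if n = 0 then 0 else g n with ha
  set ℓ : ℕ → ℝ := fun n => Real.log n with hℓ
  have ha0 : ∀ n, 0 ≤ a n := fun n => by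
    simp only [ha]; split_ifs; exacts [le_rfl, hg n]
  have hℓ0 : ∀ n, 0 ≤ ℓ n := fun n => Real.log_natCast_nonneg n
  have hLg : ∀ s : ℂ, LSeries (fun n => ((g n : ℝ) : ℂ)) s = Landau.genDirichlet a ℓ s := fun s =>
    Landau.LSeries_eq_genDirichlet g s
  have hSg : ∀ σ : ℝ, LSeriesSummable (fun n => ((g n : ℝ) : ℂ)) σ ↔
      Summable fun n : ℕ => a n * Real.exp (-(ℓ n * σ)) := fun σ =>
    Landau.LSeriesSummable_ofReal_iff g σ
  have h₁ : Summable fun n : ℕ => a n * Real.exp (-(ℓ n * 2)) := (hSg 2).1 h2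
  have hset : {s : ℂ | a₀ < s.re ∧ s.re < 4 ∧ -δ < s.im ∧ s.im < δ} =
      {s : ℂ | a₀ < s.re} ∩ ({s : ℂ | s.re < 4} ∩ ({s : ℂ | -δ < s.im} ∩ {s : ℂ | s.im < δ})) := by
    ext s; simp
  have hRoc : IsOpen {s : ℂ | a₀ < s.re ∧ s.re < 4 ∧ -δ < s.im ∧ s.im < δ} ∧
      Convex ℝ {s : ℂ | a₀ < s.re ∧ s.re < 4 ∧ -δ < s.im ∧ s.im < δ} := by
    rw [hset]
    exact ⟨(isOpen_lt continuous_const continuous_re).inter ((isOpen_lt continuous_re continuous_const).inter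
      ((isOpen_lt continuous_const continuous_im).inter (isOpen_lt continuous_im continuous_const))),
      (convex_halfSpace_re_gt _).inter ((convex_halfSpace_re_lt _).inter
        ((convex_halfSpace_im_gt _).inter (convex_halfSpace_im_lt _)))⟩
  have hRr : ∀ σ : ℝ, a₀ < σ → σ ≤ 2 + 1 → (σ : ℂ) ∈
      {s : ℂ | a₀ < s.re ∧ s.re < 4 ∧ -δ < s.im ∧ s.im < δ} := fun σ h1 h2 => by
    refine ⟨?_, ?_, ?_, ?_⟩ <;> simp only [ofReal_re, ofReal_im] <;> linarith
  have hagree' : EqOn Φ (Landau.genDirichlet a ℓ) {s : ℂ | 2 < s.re} := fun s hs => by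
    rw [← hLg s]; exact hagree s hs
  refine abscissaOfAbsConv_le_of_forall_lt_LSeriesSummable fun y hy => (hSg y).2 ?_
  exact Landau.summable_of_differentiableOn_union_convex ha0 hℓ0 h₁ ha₀ hRoc.1 hRoc.2 hRr hΦ hagree'
    (by exact_mod_cast hy)

/-- **Pinch, surplus side.**  If the deficit `(Λ-c)₊` converges absolutely on `re s > a₀` (`a₀ ≥ 1/2`), so
does the surplus `(c-Λ)₊`: on `re s > 1`, `L_{(c-Λ)₊} = F + ζ₁'/ζ₁ + L_{(Λ-c)₊}`, whose right side is
holomorphic on `{re s > 2} ∪ (a₀, 4) × (-δ, δ)` (`F` on `re s > 1/2`; `ζ₁ ≠ 0` on the strip about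
`[1/2, 5]`, `TuranLiouville.exists_strip_riemannZeta₁_ne_zero`; the deficit series on `re s > a₀`), and
Landau's theorem applies to the non-negative series `(c-Λ)₊`. [folklore] -/
theorem abscissa_posPart_le_of_deficit {c : ℕ → ℝ} (hc : ∀ n, 0 ≤ c n)
    (hsum : ∀ σ : ℝ, 1 < σ → LSeriesSummable (fun n => ((c n : ℝ) : ℂ)) σ) {F : ℂ → ℂ}
    (hFd : DifferentiableOn ℂ F {s : ℂ | 1 / 2 < s.re})
    (hF : ∀ s : ℂ, 1 < s.re → F s = LSeries (fun n => ((c n : ℝ) : ℂ)) s - 1 / (s - 1))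
    {a₀ : ℝ} (ha₀ : 1 / 2 ≤ a₀)
    (hd : abscissaOfAbsConv (fun n => ((max (Λ n - c n) 0 : ℝ) : ℂ)) ≤ a₀) :
    abscissaOfAbsConv (fun n => ((max (c n - Λ n) 0 : ℝ) : ℂ)) ≤ a₀ := by
  set fu : ℕ → ℂ := fun n => ((max (c n - Λ n) 0 : ℝ) : ℂ) with hfu
  set fd : ℕ → ℂ := fun n => ((max (Λ n - c n) 0 : ℝ) : ℂ) with hfd
  rcases le_or_gt 1 a₀ with h1a | h1a
  · exact (abscissa_posPart_le_one hc hsum).2.1.trans (by exact_mod_cast h1a)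
  obtain ⟨δ, hδ, hfree⟩ := TuranLiouville.exists_strip_riemannZeta₁_ne_zero
  have hζ₁V : ∀ s : ℂ, 1 < s.re → riemannZeta₁ s ≠ 0 := fun s hs => (neg_deriv_riemannZeta_div_eq hs).1
  have hζ₁d : ∀ s : ℂ, riemannZeta₁ s ≠ 0 → DifferentiableAt ℂ (logDeriv riemannZeta₁) s := by
    intro s hs
    have h : logDeriv riemannZeta₁ = fun z ↦ deriv riemannZeta₁ z / riemannZeta₁ z := by
      funext z; rw [logDeriv_apply]
    rw [h]
    exact (differentiable_riemannZeta₁.analyticAt s).deriv.differentiableAt.div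
      (differentiable_riemannZeta₁ s) hs
  set Φ : ℂ → ℂ := fun s => F s + logDeriv riemannZeta₁ s + LSeries fd s with hΦ
  have h2 : LSeriesSummable fu (2 : ℝ) :=
    (lseriesSummable_posPart_of_one_lt hc hsum (s := (2 : ℝ)) (by rw [ofReal_re]; norm_num)).2.1
  refine abscissa_le_of_differentiableOn_thinRect (fun n => le_max_right _ _) (by linarith) hδ h2
    (Φ := Φ) ?_ ?_
  · rintro s (hs | ⟨hs1, hs2, hs3, hs4⟩)
    · have hs' : 2 < s.re := hs
      refine ((hFd.differentiableAt ((isOpen_lt continuous_const continuous_re).mem_nhds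
        (show 1 / 2 < s.re by linarith))).add (hζ₁d s (hζ₁V s (by linarith)))).add
        ?_ |>.differentiableWithinAt
      exact (LSeries_analyticOnNhd fd s (hd.trans_lt (by exact_mod_cast (by linarith : a₀ < s.re)))).differentiableAt
    · refine ((hFd.differentiableAt ((isOpen_lt continuous_const continuous_re).mem_nhds
        (show 1 / 2 < s.re by linarith))).add (hζ₁d s ?_)).add ?_ |>.differentiableWithinAt
      · exact hfree s (by linarith) (by linarith) (abs_lt.2 ⟨by linarith, by linarith⟩)
      · exact (LSeries_analyticOnNhd fd s (hd.trans_lt (by exact_mod_cast hs1))).differentiableAt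
  · intro s hs
    simp only [hΦ]
    rw [LSeries_posPart_eq_add hc hsum hF (by linarith : 1 < s.re)]

/-- **Pinch, deficit side.**  Symmetrically: if the surplus `(c-Λ)₊` converges absolutely on `re s > a₀`
(`a₀ ≥ 1/2`), so does the deficit `(Λ-c)₊` (`L_{(Λ-c)₊} = L_{(c-Λ)₊} - F - ζ₁'/ζ₁` on `re s > 1`, Landau for
the non-negative series `(Λ-c)₊`). [folklore] -/
theorem abscissa_deficit_le_of_posPart {c : ℕ → ℝ} (hc : ∀ n, 0 ≤ c n)
    (hsum : ∀ σ : ℝ, 1 < σ → LSeriesSummable (fun n => ((c n : ℝ) : ℂ)) σ) {F : ℂ → ℂ}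
    (hFd : DifferentiableOn ℂ F {s : ℂ | 1 / 2 < s.re})
    (hF : ∀ s : ℂ, 1 < s.re → F s = LSeries (fun n => ((c n : ℝ) : ℂ)) s - 1 / (s - 1))
    {a₀ : ℝ} (ha₀ : 1 / 2 ≤ a₀)
    (hu : abscissaOfAbsConv (fun n => ((max (c n - Λ n) 0 : ℝ) : ℂ)) ≤ a₀) :
    abscissaOfAbsConv (fun n => ((max (Λ n - c n) 0 : ℝ) : ℂ)) ≤ a₀ := by
  set fu : ℕ → ℂ := fun n => ((max (c n - Λ n) 0 : ℝ) : ℂ) with hfu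
  set fd : ℕ → ℂ := fun n => ((max (Λ n - c n) 0 : ℝ) : ℂ) with hfd
  rcases le_or_gt 1 a₀ with h1a | h1a
  · exact (abscissa_posPart_le_one hc hsum).2.2.trans (by exact_mod_cast h1a)
  obtain ⟨δ, hδ, hfree⟩ := TuranLiouville.exists_strip_riemannZeta₁_ne_zero
  have hζ₁V : ∀ s : ℂ, 1 < s.re → riemannZeta₁ s ≠ 0 := fun s hs => (neg_deriv_riemannZeta_div_eq hs).1
  have hζ₁d : ∀ s : ℂ, riemannZeta₁ s ≠ 0 → DifferentiableAt ℂ (logDeriv riemannZeta₁) s := by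
    intro s hs
    have h : logDeriv riemannZeta₁ = fun z ↦ deriv riemannZeta₁ z / riemannZeta₁ z := by
      funext z; rw [logDeriv_apply]
    rw [h]
    exact (differentiable_riemannZeta₁.analyticAt s).deriv.differentiableAt.div
      (differentiable_riemannZeta₁ s) hs
  set Φ : ℂ → ℂ := fun s => LSeries fu s - F s - logDeriv riemannZeta₁ s with hΦ
  have h2 : LSeriesSummable fd (2 : ℝ) :=
    (lseriesSummable_posPart_of_one_lt hc hsum (s := (2 : ℝ)) (by rw [ofReal_re]; norm_num)).2.2
  refine abscissa_le_of_differentiableOn_thinRect (fun n => le_max_right _ _) (by linarith) hδ h2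
    (Φ := Φ) ?_ ?_
  · rintro s (hs | ⟨hs1, hs2, hs3, hs4⟩)
    · have hs' : 2 < s.re := hs
      refine ((?_ : DifferentiableAt ℂ (LSeries fu) s).sub (hFd.differentiableAt ((isOpen_lt continuous_const
        continuous_re).mem_nhds (show 1 / 2 < s.re by linarith)))).sub
        (hζ₁d s (hζ₁V s (by linarith))) |>.differentiableWithinAt
      exact (LSeries_analyticOnNhd fu s (hu.trans_lt (by exact_mod_cast (by linarith : a₀ < s.re)))).differentiableAt
    · refine ((?_ : DifferentiableAt ℂ (LSeries fu) s).sub (hFd.differentiableAt ((isOpen_lt continuous_const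
        continuous_re).mem_nhds (show 1 / 2 < s.re by linarith)))).sub (hζ₁d s ?_) |>.differentiableWithinAt
      · exact (LSeries_analyticOnNhd fu s (hu.trans_lt (by exact_mod_cast hs1))).differentiableAt
      · exact hfree s (by linarith) (by linarith) (abs_lt.2 ⟨by linarith, by linarith⟩)
  · intro s hs
    simp only [hΦ]
    rw [LSeries_posPart_eq_add hc hsum hF (by linarith : 1 < s.re)]
    ring

/-! ## Assembly -/

/-- **The Landau pinch under an off-line zero.**  Let `c ≥ 0` with `Σ c(n) n^{-σ} < ∞` (`σ > 1`) and let
`F`, holomorphic on `re s > 1/2`, continue `L_c(s) - 1/(s-1)`.  If `ζ(ρ) = 0` with `re ρ > 1/2`, then the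
surplus `(c-Λ)₊` and the deficit `(Λ-c)₊` have the SAME abscissa of absolute convergence `σ*`, and
`σ* ≥ re ρ`: both halves of the defect diverge at every `σ < re ρ`. [folklore] -/
theorem abscissa_posPart_eq_of_riemannZeta_eq_zero :
    ∀ c : ℕ → ℝ, (∀ n, 0 ≤ c n) → (∀ σ : ℝ, 1 < σ → LSeriesSummable (fun n => ((c n : ℝ) : ℂ)) σ) → (∃ F : ℂ →
    ℂ, DifferentiableOn ℂ F {s : ℂ | 1 / 2 < s.re} ∧ ∀ s : ℂ, 1 < s.re → F s = LSeries (fun n => ((c n : ℝ) :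
    ℂ)) s - 1 / (s - 1)) → ∀ ρ : ℂ, riemannZeta ρ = 0 → 1 / 2 < ρ.re → LSeries.abscissaOfAbsConv (fun n =>
    ((max (c n - ArithmeticFunction.vonMangoldt n) 0 : ℝ) : ℂ)) = LSeries.abscissaOfAbsConv (fun n => ((max
    (ArithmeticFunction.vonMangoldt n - c n) 0 : ℝ) : ℂ)) ∧ (ρ.re : EReal) ≤ LSeries.abscissaOfAbsConv (fun n
    => ((max (ArithmeticFunction.vonMangoldt n - c n) 0 : ℝ) : ℂ)) := by
  intro c hc hsum hF ρ hζ hρ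
  obtain ⟨F, hFd, hFe⟩ := hF
  set A : EReal := abscissaOfAbsConv (fun n => ((max (c n - Λ n) 0 : ℝ) : ℂ)) with hA
  set B : EReal := abscissaOfAbsConv (fun n => ((max (Λ n - c n) 0 : ℝ) : ℂ)) with hB
  have hmax : (ρ.re : EReal) ≤ max A B := re_le_max_abscissa_posPart hc hsum hFd hFe hζ hρ
  have hA1 : A ≤ (1 : ℝ) := (abscissa_posPart_le_one hc hsum).2.1
  have hB1 : B ≤ (1 : ℝ) := (abscissa_posPart_le_one hc hsum).2.2
  -- Step 1: `re ρ ≤ B`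
  have hρB : (ρ.re : EReal) ≤ B := by
    by_contra! hBρ
    -- then `A ≥ re ρ > B`; Landau for the surplus at a real `a₀ ∈ [B, re ρ)`, `a₀ ≥ 1/2`
    have hρA : (ρ.re : EReal) ≤ A := by
      rcases le_total A B with hAB | hAB
      · exact absurd (hmax.trans (max_le hAB le_rfl)) (not_le.2 hBρ)
      · exact hmax.trans (max_le le_rfl hAB)
    obtain ⟨x, hBx, hxρ⟩ := EReal.lt_iff_exists_real_btwn.1 hBρ
    set a₀ : ℝ := max x (1 / 2) with ha₀
    have ha₀ρ : a₀ < ρ.re := max_lt (by exact_mod_cast hxρ) hρ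
    have hBa₀ : B ≤ a₀ := hBx.le.trans (by exact_mod_cast le_max_left _ _)
    have hAa₀ : A ≤ a₀ := abscissa_posPart_le_of_deficit hc hsum hFd hFe (le_max_right _ _) hBa₀
    have : (ρ.re : EReal) ≤ a₀ := hρA.trans hAa₀
    exact absurd (by exact_mod_cast this : ρ.re ≤ a₀) (not_le.2 ha₀ρ)
  -- Step 2: `re ρ ≤ A` symmetrically
  have hρA : (ρ.re : EReal) ≤ A := by
    by_contra! hAρ
    obtain ⟨x, hAx, hxρ⟩ := EReal.lt_iff_exists_real_btwn.1 hAρ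
    set a₀ : ℝ := max x (1 / 2) with ha₀
    have ha₀ρ : a₀ < ρ.re := max_lt (by exact_mod_cast hxρ) hρ
    have hAa₀ : A ≤ a₀ := hAx.le.trans (by exact_mod_cast le_max_left _ _)
    have hBa₀ : B ≤ a₀ := abscissa_deficit_le_of_posPart hc hsum hFd hFe (le_max_right _ _) hAa₀
    have : (ρ.re : EReal) ≤ a₀ := hρB.trans hBa₀
    exact absurd (by exact_mod_cast this : ρ.re ≤ a₀) (not_le.2 ha₀ρ)
  -- Step 3: `A`, `B` are real numbers in `(1/2, 1]`, and each is `≤` the other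
  have hAtop : A ≠ ⊤ := ne_top_of_le_ne_top (EReal.coe_ne_top 1) hA1
  have hBtop : B ≠ ⊤ := ne_top_of_le_ne_top (EReal.coe_ne_top 1) hB1
  have hAbot : A ≠ ⊥ := ne_bot_of_gt ((EReal.bot_lt_coe ρ.re).trans_le hρA)
  have hBbot : B ≠ ⊥ := ne_bot_of_gt ((EReal.bot_lt_coe ρ.re).trans_le hρB)
  have hAr : A = (A.toReal : EReal) := (EReal.coe_toReal hAtop hAbot).symm
  have hBr : B = (B.toReal : EReal) := (EReal.coe_toReal hBtop hBbot).symm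
  have hAhalf : 1 / 2 ≤ A.toReal := by
    have h : ((1 / 2 : ℝ) : EReal) ≤ A.toReal := by
      rw [← hAr]; exact (le_of_lt (by exact_mod_cast hρ)).trans hρA
    exact_mod_cast h
  have hBhalf : 1 / 2 ≤ B.toReal := by
    have h : ((1 / 2 : ℝ) : EReal) ≤ B.toReal := by
      rw [← hBr]; exact (le_of_lt (by exact_mod_cast hρ)).trans hρB
    exact_mod_cast h
  have hAB : A ≤ B := by
    have := abscissa_posPart_le_of_deficit hc hsum hFd hFe hBhalf (by rw [← hBr])
    rwa [← hBr] at this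
  have hBA : B ≤ A := by
    have := abscissa_deficit_le_of_posPart hc hsum hFd hFe hAhalf (by rw [← hAr])
    rwa [← hAr] at this
  exact ⟨le_antisymm hAB hBA, hρB⟩

/-- **`¬ RH` corollary: two-sided divergence.**  If RH fails, every weight `c ≥ 0` with
`Σ c(n) n^{-σ} < ∞` (`σ > 1`) whose `L_c - 1/(s-1)` continues holomorphically to `re s > 1/2` has, for some
`θ > 1/2` (the real part of an off-line zero), NEITHER a summable surplus series `Σ (c-Λ)₊(n) n^{-σ}` NOR a
summable deficit series `Σ (Λ-c)₊(n) n^{-σ}` at any real `σ < θ`. [folklore] -/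
theorem not_lseriesSummable_posPart_of_not_riemannHypothesis :
    ¬ RiemannHypothesis → ∀ c : ℕ → ℝ, (∀ n, 0 ≤ c n) → (∀ σ : ℝ, 1 < σ → LSeriesSummable (fun n => ((c n : ℝ)
    : ℂ)) σ) → (∃ F : ℂ → ℂ, DifferentiableOn ℂ F {s : ℂ | 1 / 2 < s.re} ∧ ∀ s : ℂ, 1 < s.re → F s = LSeries
    (fun n => ((c n : ℝ) : ℂ)) s - 1 / (s - 1)) → ∃ θ : ℝ, 1 / 2 < θ ∧ ∀ σ : ℝ, σ < θ → ¬ LSeriesSummable (fun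
    n => ((max (c n - ArithmeticFunction.vonMangoldt n) 0 : ℝ) : ℂ)) σ ∧ ¬ LSeriesSummable (fun n => ((max
    (ArithmeticFunction.vonMangoldt n - c n) 0 : ℝ) : ℂ)) σ := by
  intro hRH c hc hsum hF
  -- an off-line zero from `¬ RH`
  have hQ : ¬ QuasiRiemannHypothesis (1 / 2) := fun h =>
    hRH (quasiRiemannHypothesis_one_half_iff_holds.1 h)
  simp only [QuasiRiemannHypothesis, not_forall] at hQ
  obtain ⟨ρ, hζ, hρ, -, -⟩ := hQ
  obtain ⟨hAB, hρB⟩ := abscissa_posPart_eq_of_riemannZeta_eq_zero c hc hsum hF ρ hζ hρ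
  refine ⟨ρ.re, hρ, fun σ hσ => ⟨fun h => ?_, fun h => ?_⟩⟩
  · have h1 := h.abscissaOfAbsConv_le
    rw [ofReal_re, hAB] at h1
    have : (ρ.re : EReal) ≤ σ := hρB.trans h1
    exact absurd (by exact_mod_cast this : ρ.re ≤ σ) (not_le.2 hσ)
  · have h1 := h.abscissaOfAbsConv_le
    rw [ofReal_re] at h1
    have : (ρ.re : EReal) ≤ σ := hρB.trans h1
    exact absurd (by exact_mod_cast this : ρ.re ≤ σ) (not_le.2 hσ)

end Summit.RiemannHypothesis.RiemannHypothesis.Theorems.SignConeConeMagnification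

end
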